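import Summits.QuantumFields.BalabanUV.T4Continuum.Support.NE7PlaquetteQuotientGradient
import Summits.QuantumFields.BalabanUV.T4Continuum.Support.NE7CubicVertexLetters
import Summits.QuantumFields.BalabanUV.T4Continuum.Support.NE7ExpansionRemainderCurvedWeak
import Literature.Analysis.FluidPDE.GalerkinSmoothLimit
import HarnessLib

/-!
# NE7SegmentPlaquetteGradient — socket `h′` SUPPLIER LINE, stub (S-b)₂ brick (ROAD-G106 §6 «products: ∇f(s) =: g(s)»): THE PLAQUETTE-GRADIENT RADIUS ALONG
# THE SEGMENT `V_s = W·e^{sX}` — the transported adjacent difference `g(s) = Ad_{V_s(z,λ)} V_s(∂p′) − V_s(∂p)` of the moving plaquette variable obeys the linear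
# differential inequality `‖g′(s)‖ ≤ 4α·‖g(s)‖ + (2α·x′ + Γ)` and hence, by Grönwall, `‖g(s)‖ ≤ (‖g(0)‖ + 2α x′ + Γ)·e^{4α}` on `[0, 1]`
# (`x′` = plaquette radius of `V_s` at `p′`, `Γ` = the transported adjacent difference of the dressed curl along the segment — both HYPOTHESES)

Cell `pub-balaban`, rung (B)+1 sub-cell t4, lineage `b2b-balaban-t4-ne7-p1`, generation 106 (CRUX PROVER NE7 #1 = OWNER of BINDER row NE7).
Memo `t4/b2b-balaban-t4-ne7-p1-g106/ROAD-G106.md` §6.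
WHY.  The Lipschitz letter for the second-order remainder `E₂ = U′(∂p) − W(∂p) − (d_W X)(p)·W(∂p)` of the reverse curl reading ((S-b)₂) is a product computation
along the segment `s ↦ V_s`; its one non-algebraic ingredient is the growth of the plaquette-GRADIENT radius of `V_s` with `s`, which is governed by the dressed curl's
own adjacent differences (`Γ`) — THIS FILE.
WHAT ([folklore]; 0 def, 0 sorry; any dimension, any `U(n)`).
 * §1 the Grönwall majorant bound is the tree's `Literature.Analysis.FluidPDE.GalerkinSmooth.gronwallBound_le_mul_exp`.
 * §2 `hasDerivAt_transPlaq_vary` — AT `t = 0`, for any base `V`: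
   `d∕dt [Ad_{V_t(z,λ)} V_t(∂p′) − V_t(∂p)] = Ad_{V(z,λ)} (X_{zλ}·Y₀ − Y₀·X_{zλ} + (d_V X)(p′)·Y₀) − (d_V X)(p)·V(∂p)`, `Y₀ = V(∂p′)`, `p′ = p + e_λ`; `hasDerivAt_transPlaq_vary_at` — at every `s`
   for the base `W` (`vary_add`).
 * §3 `norm_transPlaq_deriv_le` — for unitary `V`, skew `X` with `‖X‖ ≤ α`: the derivative has norm `≤ 4α·‖g‖ + 2α·‖V(∂p′) − 1‖ + ‖Ad_{V(z,λ)}(d_V X)(p′) − (d_V X)(p)‖`.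
 * §4 **`norm_transPlaq_vary_le`** — `W` unitary, `X` skew, `‖X‖ ≤ α`; `x′ ≥ ‖V_s(∂p′) − 1‖` and `Γ ≥ ‖Ad_{V_s(z,λ)}(d_{V_s}X)(p′) − (d_{V_s}X)(p)‖` for all `s ∈ [0,1]`;
   `x₁ ≥ ‖Ad_{W(z,λ)} W(∂p′) − W(∂p)‖` ⟹ for every `s ∈ [0,1]`: `‖Ad_{V_s(z,λ)} V_s(∂p′) − V_s(∂p)‖ ≤ (x₁ + (2α·x′ + Γ)·s)·e^{4α·s} ≤ (x₁ + 2α·x′ + Γ)·e^{4α}`.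
HONEST FRAMING (page 1): first-order calculus on one configuration along one segment; the radii and `Γ` are HYPOTHESES; nothing of Bałaban's asserted as an axiom; nothing
of NE3∕NE7 discharged; spine count = dagwriter∕referees' call; FIXED FINITE T⁴, rung (B)+1 — NOT infinite volume, NOT mass gap, NOT BetaPertH, NOT Clay.
-/

set_option autoImplicit false

open scoped BigOperators Matrix Matrix.Norms.L2Operator
open Finset NormedSpace Set

namespace Summit.QuantumFields.BalabanUV.T4Continuum.NE7SegmentPlaquetteGradient

open Literature.MathematicalPhysics.QuantumFieldTheory.Balaban1983to89
open B7Prop1Explicit B7Prop2Explicit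
open T4AveragingDeficitWall hiding Site Plane Plaq Bond
open T4AveragingDeficitNonAbelian (Ad_mul Ad_sub U1_of_unitaryUnits)
open AveragingDeficitTransport (norm_Ad_of_unitary)
open AveragingDeficitPlaqDeriv (vary_isUnitaryCfg)
open NE3HessForm (vary_add)
open NE3HessContinuity (bondL1At bondL1At_nonneg)
open NE3HessBounds (norm_comm_le)
open NE7CubicVertexLetters (bondL1At_le_of_sup)
open NE7ExpansionRemainderCurvedWeak (norm_curlAt_le_bondL1At)
open NE7PlaquetteQuotientGradient (Ad_mul_right)
open Literature.Analysis.FluidPDE.GalerkinSmooth (gronwallBound_le_mul_exp)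

noncomputable section

variable {d : ℕ} {n : Type*} [Fintype n] [DecidableEq n]

/-! ## §1 (The crude Grönwall majorant bound `gronwallBound δ K ε x ≤ (δ + εx)e^{Kx}` is `Literature.Analysis.FluidPDE.GalerkinSmooth.gronwallBound_le_mul_exp`.) -/

/-! ## §2 The derivative of the transported adjacent plaquette difference along the segment -/

/-- The bond variable along the segment, written out: `(V e^{tX})(z,λ) = V(z,λ)·e^{tX(z,λ)}` and its inverse `e^{−tX(z,λ)}·V(z,λ)⁻¹`. [folklore] -/
theorem val_vary_bond (V : Site d → Fin d → (Matrix n n ℂ)ˣ) (X : Site d → Fin d → Matrix n n ℂ) (t : ℝ) (z : Site d) (lam : Fin d) :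
    ((vary V X t z lam : (Matrix n n ℂ)ˣ) : Matrix n n ℂ) = (V z lam : Matrix n n ℂ) * exp ((t : ℂ) • X z lam) ∧
    (((vary V X t z lam)⁻¹ : (Matrix n n ℂ)ˣ) : Matrix n n ℂ) = exp (-((t : ℂ) • X z lam)) * (((V z lam)⁻¹ : (Matrix n n ℂ)ˣ) : Matrix n n ℂ) := by
  refine ⟨by simp only [vary, Units.val_mul, val_expUnit], ?_⟩
  simp only [vary, mul_inv_rev, Units.val_mul, val_inv_expUnit, val_expUnit]

/-- **THE DERIVATIVE AT `t = 0`** (any base `V`): with `Y₀ = V(∂p′)`, `p′ = (z + e_λ; μ, ν)`, `p = (z; μ, ν)`,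
`d∕dt|₀ [Ad_{V_t(z,λ)} V_t(∂p′) − V_t(∂p)] = Ad_{V(z,λ)} (X_{zλ}·Y₀ − Y₀·X_{zλ} + (d_V X)(p′)·Y₀) − (d_V X)(p)·V(∂p)`. [folklore] -/
theorem hasDerivAt_transPlaq_vary (V : Site d → Fin d → (Matrix n n ℂ)ˣ) (X : Site d → Fin d → Matrix n n ℂ) (z : Site d) (lam μ ν : Fin d) :
    HasDerivAt (fun t : ℝ => Ad (vary V X t z lam) ((hol (vary V X t) (z + e lam) (plaqWord μ ν) : (Matrix n n ℂ)ˣ) : Matrix n n ℂ)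
        - ((hol (vary V X t) z (plaqWord μ ν) : (Matrix n n ℂ)ˣ) : Matrix n n ℂ))
      (Ad (V z lam) (X z lam * ((hol V (z + e lam) (plaqWord μ ν) : (Matrix n n ℂ)ˣ) : Matrix n n ℂ)
          - ((hol V (z + e lam) (plaqWord μ ν) : (Matrix n n ℂ)ˣ) : Matrix n n ℂ) * X z lam
          + curlAt V X (z + e lam) μ ν * ((hol V (z + e lam) (plaqWord μ ν) : (Matrix n n ℂ)ˣ) : Matrix n n ℂ))
        - curlAt V X z μ ν * ((hol V z (plaqWord μ ν) : (Matrix n n ℂ)ˣ) : Matrix n n ℂ)) 0 := by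
  set A : (Matrix n n ℂ)ˣ := V z lam with hA
  set Xb : Matrix n n ℂ := X z lam with hXb
  set Y₀ : Matrix n n ℂ := ((hol V (z + e lam) (plaqWord μ ν) : (Matrix n n ℂ)ˣ) : Matrix n n ℂ) with hY₀
  -- the four differentiable factors
  have he : HasDerivAt (fun t : ℝ => exp ((t : ℂ) • Xb)) Xb 0 := hasDerivAt_exp_smul_zero Xb
  have hei : HasDerivAt (fun t : ℝ => exp (-((t : ℂ) • Xb))) (-Xb) 0 := hasDerivAt_exp_neg_smul_zero Xb
  have hY := hasDerivAt_hol_vary V X (z + e lam) μ ν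
  have hZ := hasDerivAt_hol_vary V X z μ ν
  -- the conjugated product `A e(t) Y(t) e(t)⁻¹ A⁻¹`
  have H := ((((he.const_mul (A : Matrix n n ℂ)).mul hY).mul hei).mul_const (((A⁻¹ : (Matrix n n ℂ)ˣ) : Matrix n n ℂ))).sub hZ
  refine HasDerivAt.congr_deriv (H.congr_of_eventuallyEq (Filter.Eventually.of_forall fun t => ?_)) ?_
  · simp only [Pi.sub_apply, Pi.mul_apply, Ad, (val_vary_bond V X t z lam).1, (val_vary_bond V X t z lam).2, mul_assoc, hA, hXb]
  · simp only [Pi.mul_apply, vary_zero, Complex.ofReal_zero, zero_smul, neg_zero, exp_zero, mul_one, ← hY₀, Ad, mul_add, add_mul,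
      mul_sub, sub_mul, mul_neg, neg_mul, mul_assoc]
    abel

/-- **THE DERIVATIVE AT EVERY `s`** for the base `W` (shift by `vary_add : vary W X (s + t) = vary (vary W X s) X t`). [folklore] -/
theorem hasDerivAt_transPlaq_vary_at (W : Site d → Fin d → (Matrix n n ℂ)ˣ) (X : Site d → Fin d → Matrix n n ℂ) (z : Site d) (lam μ ν : Fin d) (s : ℝ) :
    HasDerivAt (fun t : ℝ => Ad (vary W X t z lam) ((hol (vary W X t) (z + e lam) (plaqWord μ ν) : (Matrix n n ℂ)ˣ) : Matrix n n ℂ)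
        - ((hol (vary W X t) z (plaqWord μ ν) : (Matrix n n ℂ)ˣ) : Matrix n n ℂ))
      (Ad (vary W X s z lam) (X z lam * ((hol (vary W X s) (z + e lam) (plaqWord μ ν) : (Matrix n n ℂ)ˣ) : Matrix n n ℂ)
          - ((hol (vary W X s) (z + e lam) (plaqWord μ ν) : (Matrix n n ℂ)ˣ) : Matrix n n ℂ) * X z lam
          + curlAt (vary W X s) X (z + e lam) μ ν * ((hol (vary W X s) (z + e lam) (plaqWord μ ν) : (Matrix n n ℂ)ˣ) : Matrix n n ℂ))
        - curlAt (vary W X s) X z μ ν * ((hol (vary W X s) z (plaqWord μ ν) : (Matrix n n ℂ)ˣ) : Matrix n n ℂ)) s := by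
  have h0 := hasDerivAt_transPlaq_vary (vary W X s) X z lam μ ν
  have h1 : HasDerivAt (fun t : ℝ => t - s) 1 s := by simpa using (hasDerivAt_id s).sub_const s
  have h2 := h0.scomp_of_eq s h1 (by simp)
  refine (h2.congr_of_eventuallyEq (Filter.Eventually.of_forall fun t => ?_)).congr_deriv (by simp)
  simp only [Function.comp_def, ← vary_add, add_sub_cancel]

/-! ## §3 The norm of the derivative -/

/-- **THE LINEAR DIFFERENTIAL INEQUALITY** (unitary `V`, skew `X` with `‖X‖ ≤ α`): the derivative of §2 has norm
`≤ 4α·‖g‖ + 2α·‖V(∂p′) − 1‖ + ‖Ad_{V(z,λ)} (d_V X)(p′) − (d_V X)(p)‖`, where `g = Ad_{V(z,λ)} V(∂p′) − V(∂p)`. [folklore] -/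
theorem norm_transPlaq_deriv_le [Nonempty n] {V : Site d → Fin d → (Matrix n n ℂ)ˣ} (hV : IsUnitaryCfg V)
    {X : Site d → Fin d → Matrix n n ℂ} {α : ℝ} (hXα : ∀ x κ, ‖X x κ‖ ≤ α) (z : Site d) (lam μ ν : Fin d) :
    ‖Ad (V z lam) (X z lam * ((hol V (z + e lam) (plaqWord μ ν) : (Matrix n n ℂ)ˣ) : Matrix n n ℂ)
          - ((hol V (z + e lam) (plaqWord μ ν) : (Matrix n n ℂ)ˣ) : Matrix n n ℂ) * X z lam
          + curlAt V X (z + e lam) μ ν * ((hol V (z + e lam) (plaqWord μ ν) : (Matrix n n ℂ)ˣ) : Matrix n n ℂ))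
        - curlAt V X z μ ν * ((hol V z (plaqWord μ ν) : (Matrix n n ℂ)ˣ) : Matrix n n ℂ)‖
      ≤ 4 * α * ‖Ad (V z lam) ((hol V (z + e lam) (plaqWord μ ν) : (Matrix n n ℂ)ˣ) : Matrix n n ℂ) - ((hol V z (plaqWord μ ν) : (Matrix n n ℂ)ˣ) : Matrix n n ℂ)‖
        + 2 * α * ‖((hol V (z + e lam) (plaqWord μ ν) : (Matrix n n ℂ)ˣ) : Matrix n n ℂ) - 1‖
        + ‖Ad (V z lam) (curlAt V X (z + e lam) μ ν) - curlAt V X z μ ν‖ := by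
  set A : (Matrix n n ℂ)ˣ := V z lam with hA
  set Xb : Matrix n n ℂ := X z lam with hXb
  set Y₀ : Matrix n n ℂ := ((hol V (z + e lam) (plaqWord μ ν) : (Matrix n n ℂ)ˣ) : Matrix n n ℂ) with hY₀
  set Z₀ : Matrix n n ℂ := ((hol V z (plaqWord μ ν) : (Matrix n n ℂ)ˣ) : Matrix n n ℂ) with hZ₀
  set c' : Matrix n n ℂ := curlAt V X (z + e lam) μ ν with hc'
  set c : Matrix n n ℂ := curlAt V X z μ ν with hc
  set g : Matrix n n ℂ := Ad A Y₀ - Z₀ with hg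
  have hAu : A ∈ unitaryUnits (Matrix n n ℂ) := hV z lam
  have hU1 : ∀ x κ, V x κ ∈ U1 (Matrix n n ℂ) := fun x κ => U1_of_unitaryUnits (hV x κ)
  have hY1 : ‖Y₀‖ ≤ 1 := (mem_U1.mp (hol_mem hU1 (z + e lam) (plaqWord μ ν))).1
  have hα0 : 0 ≤ α := (norm_nonneg _).trans (hXα z lam)
  have hc4 : ‖c‖ ≤ 4 * α := (norm_curlAt_le_bondL1At hV X z μ ν).trans (bondL1At_le_of_sup hXα z μ ν)
  -- the rearrangement: `Ad_A([X,Y₀] + c′Y₀) − cZ₀ = Ad_A [X, Y₀ − 1] + (Ad_A c′ − c)·Ad_A Y₀ + c·g`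
  have hsplit : Ad A (Xb * Y₀ - Y₀ * Xb + c' * Y₀) - c * Z₀
      = Ad A (Xb * (Y₀ - 1) - (Y₀ - 1) * Xb) + (Ad A c' - c) * Ad A Y₀ + c * g := by
    have e2 : (Ad A c' - c) * Ad A Y₀ = Ad A (c' * Y₀) - c * Ad A Y₀ := by rw [sub_mul, ← Ad_mul_right]
    rw [hg, e2]
    unfold Ad
    noncomm_ring
  rw [hsplit]
  have t1 : ‖Ad A (Xb * (Y₀ - 1) - (Y₀ - 1) * Xb)‖ ≤ 2 * α * ‖Y₀ - 1‖ := by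
    rw [norm_Ad_of_unitary hAu]
    calc ‖Xb * (Y₀ - 1) - (Y₀ - 1) * Xb‖ ≤ 2 * (‖Xb‖ * ‖Y₀ - 1‖) := norm_comm_le _ _
      _ ≤ 2 * (α * ‖Y₀ - 1‖) := by gcongr; exact hXα z lam
      _ = 2 * α * ‖Y₀ - 1‖ := by ring
  have t2 : ‖(Ad A c' - c) * Ad A Y₀‖ ≤ ‖Ad A c' - c‖ := by
    calc ‖(Ad A c' - c) * Ad A Y₀‖ ≤ ‖Ad A c' - c‖ * ‖Ad A Y₀‖ := norm_mul_le _ _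
      _ ≤ ‖Ad A c' - c‖ * 1 := by
          gcongr; rw [norm_Ad_of_unitary hAu]; exact hY1
      _ = ‖Ad A c' - c‖ := mul_one _
  have t3 : ‖c * g‖ ≤ 4 * α * ‖g‖ := (norm_mul_le _ _).trans (mul_le_mul_of_nonneg_right hc4 (norm_nonneg _))
  calc ‖Ad A (Xb * (Y₀ - 1) - (Y₀ - 1) * Xb) + (Ad A c' - c) * Ad A Y₀ + c * g‖
      ≤ ‖Ad A (Xb * (Y₀ - 1) - (Y₀ - 1) * Xb)‖ + ‖(Ad A c' - c) * Ad A Y₀‖ + ‖c * g‖ := norm_add₃_le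
    _ ≤ 2 * α * ‖Y₀ - 1‖ + ‖Ad A c' - c‖ + 4 * α * ‖g‖ := by linarith
    _ = 4 * α * ‖g‖ + 2 * α * ‖Y₀ - 1‖ + ‖Ad A c' - c‖ := by ring

/-! ## §4 Grönwall along the segment -/

/-- **THE PLAQUETTE-GRADIENT RADIUS ALONG THE SEGMENT.**  `W` unitary, `X` skew with `‖X‖ ≤ α`; uniform data on `[0,1]`: `x′ ≥ ‖V_s(∂p′) − 1‖`,
`Γ ≥ ‖Ad_{V_s(z,λ)} (d_{V_s}X)(p′) − (d_{V_s}X)(p)‖` (`V_s = vary W X s`); `x₁ ≥ ‖Ad_{W(z,λ)} W(∂p′) − W(∂p)‖`.  Then for every `s ∈ [0, 1]`: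
`‖Ad_{V_s(z,λ)} V_s(∂p′) − V_s(∂p)‖ ≤ (x₁ + 2α·x′ + Γ)·e^{4α}`. [folklore] -/
theorem norm_transPlaq_vary_le [Nonempty n] {W : Site d → Fin d → (Matrix n n ℂ)ˣ} (hW : IsUnitaryCfg W)
    {X : Site d → Fin d → Matrix n n ℂ} (hX : IsSkewDir X) {α : ℝ} (hXα : ∀ x κ, ‖X x κ‖ ≤ α) (z : Site d) (lam μ ν : Fin d)
    {x' Γ x₁ : ℝ} (hx' : 0 ≤ x') (hΓ : 0 ≤ Γ)
    (hxs : ∀ s ∈ Icc (0 : ℝ) 1, ‖((hol (vary W X s) (z + e lam) (plaqWord μ ν) : (Matrix n n ℂ)ˣ) : Matrix n n ℂ) - 1‖ ≤ x')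
    (hΓs : ∀ s ∈ Icc (0 : ℝ) 1, ‖Ad (vary W X s z lam) (curlAt (vary W X s) X (z + e lam) μ ν) - curlAt (vary W X s) X z μ ν‖ ≤ Γ)
    (hx₁ : ‖Ad (W z lam) ((hol W (z + e lam) (plaqWord μ ν) : (Matrix n n ℂ)ˣ) : Matrix n n ℂ) - ((hol W z (plaqWord μ ν) : (Matrix n n ℂ)ˣ) : Matrix n n ℂ)‖ ≤ x₁)
    {s : ℝ} (hs : s ∈ Icc (0 : ℝ) 1) :
    ‖Ad (vary W X s z lam) ((hol (vary W X s) (z + e lam) (plaqWord μ ν) : (Matrix n n ℂ)ˣ) : Matrix n n ℂ)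
        - ((hol (vary W X s) z (plaqWord μ ν) : (Matrix n n ℂ)ˣ) : Matrix n n ℂ)‖ ≤ (x₁ + 2 * α * x' + Γ) * Real.exp (4 * α) := by
  set G : ℝ → Matrix n n ℂ := fun t => Ad (vary W X t z lam) ((hol (vary W X t) (z + e lam) (plaqWord μ ν) : (Matrix n n ℂ)ˣ) : Matrix n n ℂ)
        - ((hol (vary W X t) z (plaqWord μ ν) : (Matrix n n ℂ)ˣ) : Matrix n n ℂ) with hGdef
  set G' : ℝ → Matrix n n ℂ := fun t =>
      Ad (vary W X t z lam) (X z lam * ((hol (vary W X t) (z + e lam) (plaqWord μ ν) : (Matrix n n ℂ)ˣ) : Matrix n n ℂ)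
          - ((hol (vary W X t) (z + e lam) (plaqWord μ ν) : (Matrix n n ℂ)ˣ) : Matrix n n ℂ) * X z lam
          + curlAt (vary W X t) X (z + e lam) μ ν * ((hol (vary W X t) (z + e lam) (plaqWord μ ν) : (Matrix n n ℂ)ˣ) : Matrix n n ℂ))
        - curlAt (vary W X t) X z μ ν * ((hol (vary W X t) z (plaqWord μ ν) : (Matrix n n ℂ)ˣ) : Matrix n n ℂ) with hG'def
  have hα0 : 0 ≤ α := (norm_nonneg _).trans (hXα z lam)
  have hderiv : ∀ t, HasDerivAt G (G' t) t := fun t => hasDerivAt_transPlaq_vary_at W X z lam μ ν t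
  have hcont : ContinuousOn G (Icc (0 : ℝ) 1) := fun t _ => (hderiv t).continuousAt.continuousWithinAt
  have hderivW : ∀ t ∈ Ico (0 : ℝ) 1, HasDerivWithinAt G (G' t) (Ici t) t := fun t _ => (hderiv t).hasDerivWithinAt
  have hbound : ∀ t ∈ Ico (0 : ℝ) 1, ‖G' t‖ ≤ 4 * α * ‖G t‖ + (2 * α * x' + Γ) := by
    intro t ht
    have ht' : t ∈ Icc (0 : ℝ) 1 := ⟨ht.1, ht.2.le⟩
    have hVu : IsUnitaryCfg (vary W X t) := vary_isUnitaryCfg hW hX t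
    have h := norm_transPlaq_deriv_le hVu hXα z lam μ ν
    have h1 := hxs t ht'
    have h2 := hΓs t ht'
    have : 2 * α * ‖((hol (vary W X t) (z + e lam) (plaqWord μ ν) : (Matrix n n ℂ)ˣ) : Matrix n n ℂ) - 1‖ ≤ 2 * α * x' :=
      mul_le_mul_of_nonneg_left h1 (by positivity)
    calc ‖G' t‖ ≤ _ := h
      _ ≤ 4 * α * ‖G t‖ + (2 * α * x' + Γ) := by linarith
  have hG0 : ‖G 0‖ ≤ x₁ := by
    have e0 : G 0 = Ad (W z lam) ((hol W (z + e lam) (plaqWord μ ν) : (Matrix n n ℂ)ˣ) : Matrix n n ℂ)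
        - ((hol W z (plaqWord μ ν) : (Matrix n n ℂ)ˣ) : Matrix n n ℂ) := by simp only [hGdef, vary_zero]
    rw [e0]; exact hx₁
  have hx₁0 : 0 ≤ x₁ := (norm_nonneg _).trans hG0
  have hgron := norm_le_gronwallBound_of_norm_deriv_right_le hcont hderivW hG0 hbound s hs
  rw [sub_zero] at hgron
  have hε0 : 0 ≤ 2 * α * x' + Γ := by positivity
  have hK0 : 0 ≤ 4 * α := by positivity
  have h1 := gronwallBound_le_mul_exp (δ := x₁) hK0 hε0 hs.1
  -- `(x₁ + ε·s)·e^{4α s} ≤ (x₁ + ε)·e^{4α}` for `s ≤ 1`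
  have h2 : (x₁ + (2 * α * x' + Γ) * s) * Real.exp (4 * α * s) ≤ (x₁ + 2 * α * x' + Γ) * Real.exp (4 * α) := by
    have hs1 : s ≤ 1 := hs.2
    have ha : x₁ + (2 * α * x' + Γ) * s ≤ x₁ + 2 * α * x' + Γ := by nlinarith
    have hb : Real.exp (4 * α * s) ≤ Real.exp (4 * α) := Real.exp_le_exp.mpr (by nlinarith)
    have ha0 : 0 ≤ x₁ + (2 * α * x' + Γ) * s := by
      have := mul_nonneg hε0 hs.1; linarith
    exact mul_le_mul ha hb (Real.exp_pos _).le (by linarith)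
  exact hgron.trans (h1.trans h2)

end

end Summit.QuantumFields.BalabanUV.T4Continuum.NE7SegmentPlaquetteGradient
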